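import Summits.HodgeConjecture.HodgeConjecture.Theorems.AnchorTransportVariationalHodgePadicFamilyModel
import Literature.AlgebraicGeometry.Limits.SmoothProjectiveFamilyModelAdjoin

/-!
# Route AnchorTransport — crux `VariationalHodge` (stmt-HodgeConjecture-1076), line `padic-disc-transport`:
# the spreading-out of the family over a model ring CONTAINING PRESCRIBED SCALARS

HONEST FRAMING: research route conditional on HC_CM; not a corollary; Q11.4-sentence-2 already refuted in dim ≥ 3.
Helper file on the crux item (nothing here closes it; no definition, no named fact, no `sorry`;
`HC_CM` does not occur). Cell `pub-hodge-ring2`, binder seat `ring2-b03` (gen 36), BINDER-OWNERS row b03.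

Refinement of `Theorems.padicFamilyModel[_of_isQuasiProjectiveOver]`: the ring `R → ℂ` of finite type
over `ℤ` carrying the smooth projective model of the family may be chosen so that its image contains
any prescribed finite set `F ⊆ ℂ` (`Limits.exists_smooth_projective_family_model_finiteType_int_finset`).
In the Maulik–Poonen disc this is how the ANCHOR CYCLE (not only the anchor point) is made to live over
the Witt point `R → W(𝔽̄_q)`: adjoin the coefficients of its equations to `R` before choosing `q`
(Maulik–Poonen 2012, §4). The disc theorem `HodgeTheory.exists_wittVector_points_same_reduction_generic`
takes the model ring as an input, so the two compose.
-/

noncomputable section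

-- every declaration of this problem lives in `Summit.HodgeConjecture.HodgeConjecture.…` (summit = sub-problem)
set_option linter.dupNamespace false

open CategoryTheory CategoryTheory.Limits AlgebraicGeometry MonoidalCategory
open Literature.AlgebraicGeometry.Motives Literature.AlgebraicGeometry.HodgeTheory

namespace Summit.HodgeConjecture.HodgeConjecture.Theorems

/-- **The spreading-out datum of STUB S over a ring containing prescribed scalars** (Maulik–Poonen
2012, §4). As `padicFamilyModel` — `f : 𝒳 ⟶ S` smooth projective of relative dimension `n` over `ℂ`,
`S` affine irreducible smooth one-dimensional, `ι : 𝒳 ⟶ S ⊗ ℙᴹ_ℂ` a closed `S`-immersion — with, for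
a finite `F ⊆ ℂ`, the ring `R` chosen so that `F ⊆ τ(R)`. [cite: MaulikPoonen2012, §4] -/
theorem padicFamilyModel_finset {n M : ℕ} {𝒳 S : SchemeOver ℂ} (f : 𝒳 ⟶ S)
    (hf : IsSmoothProjectiveFamily f n)
    [IrreducibleSpace S.left] [IsAffine S.left] (hsm : AlgebraicGeometry.Smooth S.hom)
    (hdim : topologicalKrullDim S.left = 1)
    (ι : 𝒳 ⟶ S ⊗ projectiveSpace M ℂ) [IsClosedImmersion ι.left]
    (hι : ι ≫ CartesianMonoidalCategory.fst S (projectiveSpace M ℂ) = f) (F : Finset ℂ) :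
    ∃ (R B : Type) (_ : CommRing R) (_ : CommRing B) (_ : Algebra R B) (_ : Algebra.FiniteType ℤ R)
      (_ : Algebra.FiniteType R B)
      (_ : SmoothOfRelativeDimension 1 (Spec.map (CommRingCat.ofHom (algebraMap R B))))
      (τ : R →+* ℂ) (πS : S.left ⟶ Spec (.of B))
      (_ : IsPullback πS S.hom (Spec.map (CommRingCat.ofHom (algebraMap R B)))
        (Spec.map (CommRingCat.ofHom τ)))
      (Y : Scheme.{0}) (g : Y ⟶ Spec (.of B))
      (emb : letI := MvPolynomial.gradedAlgebra (σ := Fin (M + 1)) (R := B)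
        Y ⟶ Proj (MvPolynomial.homogeneousSubmodule (Fin (M + 1)) B))
      (_ : IsClosedImmersion emb)
      (_ : letI := MvPolynomial.gradedAlgebra (σ := Fin (M + 1)) (R := B)
        emb ≫ ProjBaseChangeRing.projToSpec (Fin (M + 1)) B = g)
      (π𝒳 : 𝒳.left ⟶ Y),
      (∀ x ∈ F, x ∈ Set.range τ) ∧
      IsProper g ∧ SmoothOfRelativeDimension n g ∧ IsPullback π𝒳 f.left g πS := by
  classical
  haveI : Smooth S.hom := hsm
  obtain ⟨d, hd⟩ := exists_smoothOfRelativeDimension_of_smooth S.hom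
  haveI := hd
  haveI : IsReduced S.left := isReduced_of_smoothOfRelativeDimension S.hom d
  haveI : IsIntegral S.left := isIntegral_of_irreducibleSpace_of_isReduced _
  have hd1 : d = 1 := by
    have h := topologicalKrullDim_eq_of_smoothOfRelativeDimension S.hom d
    rw [hdim] at h
    exact_mod_cast h.symm
  subst hd1
  haveI := hf.smoothOfRelativeDimension
  obtain ⟨R, _, _, _, B, _, _, _, πS, Y, g, emb, _, hembg, π𝒳, hF, hBd, hπS, hgP, hgn, h𝒳⟩ :=
    Literature.AlgebraicGeometry.Limits.exists_smooth_projective_family_model_finiteType_int_finset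
      (d := 1) (n := n) S f ι hι F
  exact ⟨R, B, inferInstance, inferInstance, inferInstance, inferInstance, inferInstance, hBd,
    algebraMap R ℂ, πS, hπS, Y, g, emb, inferInstance, hembg, π𝒳, hF, hgP, hgn, h𝒳⟩

/-- **The same for a QUASI-PROJECTIVE total space** (`HodgeTheory.IsQuasiProjectiveOver 𝒳`; a proper
morphism from a quasi-projective scheme is projective, Hartshorne II Cor. 4.8 (e)), with the model ring
containing a prescribed finite `F ⊆ ℂ`. [cite: MaulikPoonen2012, §4]
[cite: Hartshorne1977, Ch. II Cor. 4.8 (e)] -/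
theorem padicFamilyModel_of_isQuasiProjectiveOver_finset {n : ℕ} {𝒳 S : SchemeOver ℂ} (f : 𝒳 ⟶ S)
    (hf : IsSmoothProjectiveFamily f n)
    [IrreducibleSpace S.left] [IsAffine S.left] (hsm : AlgebraicGeometry.Smooth S.hom)
    (hdim : topologicalKrullDim S.left = 1) (h𝒳 : IsQuasiProjectiveOver 𝒳) (F : Finset ℂ) :
    ∃ (M : ℕ) (R B : Type) (_ : CommRing R) (_ : CommRing B) (_ : Algebra R B)
      (_ : Algebra.FiniteType ℤ R) (_ : Algebra.FiniteType R B)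
      (_ : SmoothOfRelativeDimension 1 (Spec.map (CommRingCat.ofHom (algebraMap R B))))
      (τ : R →+* ℂ) (πS : S.left ⟶ Spec (.of B))
      (_ : IsPullback πS S.hom (Spec.map (CommRingCat.ofHom (algebraMap R B)))
        (Spec.map (CommRingCat.ofHom τ)))
      (Y : Scheme.{0}) (g : Y ⟶ Spec (.of B))
      (emb : letI := MvPolynomial.gradedAlgebra (σ := Fin (M + 1)) (R := B)
        Y ⟶ Proj (MvPolynomial.homogeneousSubmodule (Fin (M + 1)) B))
      (_ : IsClosedImmersion emb)
      (_ : letI := MvPolynomial.gradedAlgebra (σ := Fin (M + 1)) (R := B)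
        emb ≫ ProjBaseChangeRing.projToSpec (Fin (M + 1)) B = g)
      (π𝒳 : 𝒳.left ⟶ Y),
      (∀ x ∈ F, x ∈ Set.range τ) ∧
      IsProper g ∧ SmoothOfRelativeDimension n g ∧ IsPullback π𝒳 f.left g πS := by
  haveI := hf.isProper
  haveI : IsSeparated S.hom := inferInstance
  obtain ⟨M, ι, hι, hιf⟩ := exists_isClosedImmersion_tensor_projectiveSpace_of_isQuasiProjectiveOver f h𝒳
  haveI := hι
  obtain ⟨R, B, _, _, _, _, _, hBd, τ, πS, hπS, Y, g, emb, _, hembg, π𝒳, hF, hgP, hgn, h𝒳⟩ :=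
    padicFamilyModel_finset f hf hsm hdim ι hιf F
  exact ⟨M, R, B, inferInstance, inferInstance, inferInstance, inferInstance, inferInstance, hBd, τ, πS,
    hπS, Y, g, emb, inferInstance, hembg, π𝒳, hF, hgP, hgn, h𝒳⟩

end Summit.HodgeConjecture.HodgeConjecture.Theorems

end
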